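import Summits.QuantumFields.YangMills.Theorems.BalabanUVNodesN20KeyedRelWeightLevels

/-!
# BalabanUVNodes ∕ N20 (NE7b) — THE N20 COLUMN ONCE, FOR ANY CARRIERS ON dag-n20-d's KEYED CLASS SET `classSet₁₃ θ K₀ g₀` WITH THE PERSISTENCE CLASS `badClass₁₃ θ K₀ g₀ jcut`:
# every spine reading of record that keeps the keys and the cut dial and changes only the per-class WEIGHTS (`crOfRecord₁₃At ∕ VAt` — `weightA∕B₁₃`; n21-d's `crTop₁₃VAt` —
# `topWeightA∕B₁₃`; `crGap₁₃VAt` — `gapWeightA∕B₁₃`; n21-w7's pair readings; any later re-lettering) gets its N20 column from ONE nonnegativity proof per run: FREE at the zero cut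
# (no hypothesis at all), canonical `wInf` form, monotone dial, `= 1` above the window, per-birth-level ∕ survival sockets, the first-level wall and the survival–saturation honesty

Cell `pub-ymgap` (HUMAN RULING D-0062 Track A; width push D-0149, director-ym №197), width seat `pub-ymgap-dag-n20-w2` (gen 5) on node N20 = NE7b; key item K3⁸
`SpineGivenEndpointR13SepCoPHV` = stmt-QuantumFields-27366 (KEY MAP v2; K3⁷ stmt-QuantumFields-20544 aside); `--kind proof --supports … --as helper`; COUNT-NEUTRAL; LOCATED.
[LF-I] = [Balaban1989LargeFieldI], [LF-II] = [Balaban1989LargeFieldII].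

WHY.  This lineage typed the N20 face reading by reading — g0∕g2∕g3 at `crOfRecord₁₃(V)At` (p590852, p597397–p604310, p606933), g5 at n21-d's gapped reading (p630052) — with the
SAME proofs each time: only the carriers' names change, because every such reading shares dag-n20-d's index type `Σ K, SiteSeqKey F (K₀+K)`, class set `classSet₁₃ θ K₀ g₀` and
persistence class `badClass₁₃ θ K₀ g₀ jcut` (the cut dial), and the N20 face reads the carriers only through TWO facts: `0 ≤ A K t x`, `0 ≤ B K t x`.  New readings on these keys keep
appearing (n21-d's top-lettered ∕ gapped families, n21-w7's pair readings, the next re-lettering a pin may name); this file states the column ONCE at that level of generality —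
parameters `(l₀ : ℝ)` and carriers `A B : ℕ → ℝ → (Σ K, SiteSeqKey F (K₀+K)) → ℝ`, hypotheses `hA hB` (nonnegativity) only where needed — so that a reading's column is
`theorem … := generic_lemma (fun K t x => its_nonneg …) …` and its `.W` field (always `wInf l₀ (classSet₁₃ …) A B (badClass₁₃ … jcut)`) rewrites by `rfl`:
* §1 THE FREE END (NO hypothesis, not even nonnegativity): `relWeightBound_classSet₁₃_cutZero` (zero cut, zero weight) · `wInf_classSet₁₃_cutZero` (`wInf ≡ 0`) ·
  `relWeightBound_wInf_classSet₁₃_cutZero`;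
* §2 CANONICAL FORM (`0 ≤ A, B`): `one_mem_admW_classSet₁₃` · `wInf_classSet₁₃_le_one` · ★★ `relWeightBound_wInf_classSet₁₃_iff` (`RelWeightBound … (wInf …) ⟺ (∀ K, wInf K < 1) ∧
  Summable wInf`) · `exists_relWeightBound_classSet₁₃_iff`;
* §3 THE DIAL: `wInf_classSet₁₃_mono_at` (`jcut K ≤ jcut' K ⇒ wInf(jcut) K ≤ wInf(jcut') K`) · ★ `wInf_classSet₁₃_eq_one_of_overCut` (`K₀ + K < jcut K` and a positive run-A class total at
  one admissible source ⇒ `wInf K = 1` — at a reading of record the positivity is E1 + `schemeZ_pos`) · `cut_le_of_relWeightBound_classSet₁₃`;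
* §4 THE INTERIOR PRICED: ★★ `wInf_classSet₁₃_le_sum_levels` (g3's exact stratification `sum_badClass₁₃_eq_sum_strata`) · `relWeightBound_wInf_classSet₁₃_of_levelFractions` · ★★
  `wInf_classSet₁₃_le_survival` (`≤ V·r^{K₀+K−jcut K}∕(1−r)`) · `relWeightBound_wInf_classSet₁₃_of_survival ∕ _of_survival_linearAge` · ★★ `wInf_classSet₁₃_le_ageMoment` (MARKOV IN
  THE AGE CURRENCY: one `z`-exponential age moment `Σ_{j<jcut K} z^{K₀+K−(j+1)}·(stratum mass) ≤ M_K·total` per run and step ⇒ `wInf K ≤ M_K ∕ z^{age floor}`, no `1∕(1−r)` loss) ·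
  `relWeightBound_wInf_classSet₁₃_of_ageMoment`;
* §5 THE WALL and HONESTY: `le_weight_of_levelOne_fraction_classSet₁₃` · ★ `eventually_cut_eq_zero_of_relWeightBound_classSet₁₃` (eventual first-level saturation, DISPLAYED, + any
  witness ⇒ `∀ᶠ K, jcut K = 0`; dag-n20-w1 p597932's wall for any carriers) · `eventually_cut_eq_zero_of_survival_of_saturated_classSet₁₃` (g3 p613049's honesty for any carriers);
* §6 DICTIONARY (`rfl`): `W_crOfRecord₁₃VAt_eq_wInf` · `W_crOfRecord₁₃At_eq_wInf` — the readings of record ARE instances (the gapped reading's `crGap₁₃VAt_W` is n21-d's `rfl`); so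
  g2's `relWeightBound_crOfRecord₁₃VAt_iff`, g3's `W_crOfRecord₁₃VAt_le_survival`, g5's `W_crGap₁₃VAt_eq_one_of_overCut`, … are §2–§5 at `weightA∕B₁₃_nonneg` ∕ `gapWeightA∕B₁₃_nonneg`.
WHAT IT SAYS (located, count-neutral): on dag-n20-d's keys the N20 face of stub 2 is a property of the PERSISTENCE CLASS and two non-negative weight families, nothing else; whichever
reading a K3 pin names on these keys, its N20 conjunct is free at `jc ≡ 0`, walled by first-level saturation of ITS run-A carriers, and otherwise the per-birth-level survival letter at
ITS carriers (NE7b's body — NAMED OPEN).  Cited BY NAME, not re-typed: dag-n20-d `classSet₁₃ ∕ badClass₁₃ ∕ badClass₁₃_subset ∕ crOfRecord₁₃(V)At`, `…SpineCanonicalWeights`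
(`admW ∕ wInf ∕ …`); g0 `badClass₁₃_cutZero`; g2 `…Canonical` §1, `…OverCut` (`badClass₁₃_eq_classSet₁₃_of_overCut`), `…DialMonotone` (`wInf_mono_of_subset_at`); g3 `…Levels`
(`sum_badClass₁₃_eq_sum_strata`, `badClass₁₃_level_zero`, `sum_range_pow_age_le`, `summable_ageMajorant_of_linearAge`); dag-n20-w1 `…PolicyWall` (`badClass₁₃_mono_at`,
`badClass₁₃_levelOne_subset_of_one_le`); `T4BadClassBooking.le_weight_of_fraction_le`, `T4ShellCount.not_summable_of_frequently_le`.

HONEST FRAMING.  [folklore] finite-sum ∕ real-analysis bookkeeping BY NAME; NO weight bounded, NO estimate proved; every per-level ∕ survival ∕ saturation letter is a HYPOTHESIS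
(NE7b's body resp. dag-n20-w3's count — NAMED OPEN ∕ DISPLAYED); nothing of Bałaban's is asserted; NE7 ∕ NE7b ∕ NE7c NOT PRINTED for `d = 4`, NOT proved; no `Provisos₁₃CoPH`
inhabitant claimed (K0⁷ OPEN); N19 ∕ N20 ∕ N21 ∕ N27 NOT discharged; K3⁸ ∕ K3⁷ NOT closed (v6 ∕ v5 stand); counts unmoved (typed 28∕28 · discharged 5∕27); no count claim.  One
finite `𝕋⁴_{L^K}` programme at fixed `ε = L^{−K}`, Bałaban AS PRINTED; the YM mass gap (Clay) is NOT proved by any of this — R4 closes the conditional finite-𝕋⁴ rung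
`BalabanLadder.UV` only; NOT ℝ⁴, NOT infinite volume, NOT OS.  No `def`, no `instance`, no `notation`, no `sorry`.
Sources (locators, bookkeeping only): [LF-I] p.177 (i)–(ii); [LF-II] Thm 1 + (0.1) pp.355–356, (1.80) p.384, (1.85)–(1.89) pp.386–387; [King1986] (3.10)–(3.11) p.656.
-/

noncomputable section

open scoped BigOperators
open Filter Topology

namespace Summit.QuantumFields.YangMills.BalabanUVNodes.N20KeyedRelWeightAnyCarriers

open Literature.MathematicalPhysics.QuantumFieldTheory.Balaban1983to89 Literature.MathematicalPhysics.QuantumFieldTheory.Balaban1983to89.Node00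
open T4Continuum
open T4WeightBudget (RelWeightBound)
open T4BadClassBooking (le_weight_of_fraction_le)
open T4ShellCount (not_summable_of_frequently_le)
open YMDAG.UVSplit (SpineReading₁₃CoPH ShellSplit₁₃CoPH classSet₁₃ badClass₁₃ badClass₁₃_subset crOfRecord₁₃At crOfRecord₁₃VAt weightA₁₃ weightB₁₃)
open Summit.QuantumFields.YangMills.BalabanUVNodes.SpineCanonicalWeights
open Summit.QuantumFields.YangMills.BalabanUVNodes.N20KeyedRelWeightCutZero (badClass₁₃_cutZero)
open Summit.QuantumFields.YangMills.BalabanUVNodes.N20KeyedRelWeightOverCut (badClass₁₃_eq_classSet₁₃_of_overCut)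
open Summit.QuantumFields.YangMills.BalabanUVNodes.N20KeyedRelWeightCanonical (one_mem_admW relWeightBound_wInf_iff_lt_one_summable exists_relWeightBound_iff_lt_one_summable
  wInf_eq_one_of_bad_eq)
open Summit.QuantumFields.YangMills.BalabanUVNodes.N20KeyedRelWeightDialMonotone (wInf_mono_of_subset_at)
open Summit.QuantumFields.YangMills.BalabanUVNodes.N20KeyedRelWeightPolicyWall (badClass₁₃_mono_at badClass₁₃_levelOne_subset_of_one_le)
open Summit.QuantumFields.YangMills.BalabanUVNodes.N20KeyedRelWeightLevels (sum_badClass₁₃_eq_sum_strata badClass₁₃_level_zero sum_range_pow_age_le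
  summable_ageMajorant_of_linearAge)

variable {F : T4Family} {N : ℕ} [NeZero N] (θ : Stage13HParams F N) (K₀ : ℕ) (g₀ : ℕ → ℝ) (l₀ : ℝ)
  {A B : ℕ → ℝ → (Σ K, SiteSeqKey F (K₀ + K)) → ℝ}

/-! ## §1  The free end — no hypothesis at all -/

section CutZero

variable (A B)

/-- **★ `RelWeightBound` ON THE KEYED CLASS SET WITH THE ZERO CUT AND THE ZERO WEIGHT, ANY CARRIERS, NO HYPOTHESIS**: `badClass₁₃ … (fun _ ↦ 0) = ∅`, both bad sums vanish.
[cite: King1986, (3.10) p.656; Balaban1989LargeFieldII, (1.80) p.384 (bookkeeping)] -/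
theorem relWeightBound_classSet₁₃_cutZero :
    RelWeightBound l₀ (classSet₁₃ θ K₀ g₀) A B (badClass₁₃ θ K₀ g₀ (fun _ => 0)) (fun _ => 0) where
  bad_subset K t _ := badClass₁₃_subset θ K₀ g₀ _ K t
  nonneg _ := le_rfl
  lt_one _ := zero_lt_one
  summable := summable_zero
  bad_left K t _ := by rw [badClass₁₃_cutZero, Finset.sum_empty, zero_mul]
  bad_right K t _ := by rw [badClass₁₃_cutZero, Finset.sum_empty, zero_mul]

/-- **AT THE ZERO CUT THE CANONICAL WEIGHT IS `0`**, any carriers. [cite: King1986, (3.10) p.656 (bookkeeping)] -/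
theorem wInf_classSet₁₃_cutZero (K : ℕ) : wInf l₀ (classSet₁₃ θ K₀ g₀) A B (badClass₁₃ θ K₀ g₀ (fun _ => 0)) K = 0 :=
  le_antisymm (wInf_le_of_relWeightBound (relWeightBound_classSet₁₃_cutZero θ K₀ g₀ l₀ A B) K) (wInf_nonneg K)

/-- **… AND `RelWeightBound` HOLDS AT THE CANONICAL WEIGHT** there (the shape a reading's `.W` field has). [cite: King1986, (3.10) p.656 (bookkeeping)] -/
theorem relWeightBound_wInf_classSet₁₃_cutZero :
    RelWeightBound l₀ (classSet₁₃ θ K₀ g₀) A B (badClass₁₃ θ K₀ g₀ (fun _ => 0)) (wInf l₀ (classSet₁₃ θ K₀ g₀) A B (badClass₁₃ θ K₀ g₀ (fun _ => 0))) :=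
  relWeightBound_wInf (relWeightBound_classSet₁₃_cutZero θ K₀ g₀ l₀ A B)

end CutZero

/-! ## §2  Canonical form — carriers `≥ 0` -/

section Canonical

variable (hA : ∀ (K : ℕ) (t : ℝ) (x : Σ K, SiteSeqKey F (K₀ + K)), 0 ≤ A K t x) (hB : ∀ (K : ℕ) (t : ℝ) (x : Σ K, SiteSeqKey F (K₀ + K)), 0 ≤ B K t x)
  (jcut : ℕ → ℕ)
include hA hB

/-- **THE WEIGHT `1` IS ADMISSIBLE AT EVERY STEP** (carriers `≥ 0`; the persistence class consists of classes). [cite: King1986, (3.10)–(3.11) p.656 (bookkeeping)] -/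
theorem one_mem_admW_classSet₁₃ (K : ℕ) : (1 : ℝ) ∈ admW l₀ (classSet₁₃ θ K₀ g₀) A B (badClass₁₃ θ K₀ g₀ jcut) K :=
  one_mem_admW (fun K t _ x _ => hA K t x) (fun K t _ x _ => hB K t x) (fun K t _ => badClass₁₃_subset θ K₀ g₀ jcut K t) K

/-- **THE CANONICAL WEIGHT IS `≤ 1`.** [cite: King1986, (3.10)–(3.11) p.656 (bookkeeping)] -/
theorem wInf_classSet₁₃_le_one (K : ℕ) : wInf l₀ (classSet₁₃ θ K₀ g₀) A B (badClass₁₃ θ K₀ g₀ jcut) K ≤ 1 :=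
  wInf_le_of_mem (one_mem_admW_classSet₁₃ θ K₀ g₀ l₀ hA hB jcut K)

/-- **★★ THE N20 FACE ON THE KEYED CLASS SET IS TWO NUMERIC CONDITIONS ON THE CANONICAL WEIGHT**, any carriers `≥ 0`, any cut:
`RelWeightBound l₀ (classSet₁₃ …) A B (badClass₁₃ … jcut) (wInf …) ⟺ (∀ K, wInf … K < 1) ∧ Summable (wInf …)`.
[cite: Balaban1989LargeFieldII, Thm 1 + (0.1) pp.355–356, (1.80) p.384; King1986, (3.10)–(3.11) p.656 (bookkeeping)] -/
theorem relWeightBound_wInf_classSet₁₃_iff :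
    RelWeightBound l₀ (classSet₁₃ θ K₀ g₀) A B (badClass₁₃ θ K₀ g₀ jcut) (wInf l₀ (classSet₁₃ θ K₀ g₀) A B (badClass₁₃ θ K₀ g₀ jcut)) ↔
      (∀ K, wInf l₀ (classSet₁₃ θ K₀ g₀) A B (badClass₁₃ θ K₀ g₀ jcut) K < 1) ∧ Summable (wInf l₀ (classSet₁₃ θ K₀ g₀) A B (badClass₁₃ θ K₀ g₀ jcut)) :=
  relWeightBound_wInf_iff_lt_one_summable (fun K t _ x _ => hA K t x) (fun K t _ x _ => hB K t x) fun K t _ => badClass₁₃_subset θ K₀ g₀ jcut K t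

/-- **SOME WITNESS ⟺ THE SAME TWO CONDITIONS ON THE CANONICAL WEIGHT.** [cite: Balaban1989LargeFieldII, (1.80) p.384; King1986, (3.10)–(3.11) p.656 (bookkeeping)] -/
theorem exists_relWeightBound_classSet₁₃_iff :
    (∃ W : ℕ → ℝ, RelWeightBound l₀ (classSet₁₃ θ K₀ g₀) A B (badClass₁₃ θ K₀ g₀ jcut) W) ↔
      (∀ K, wInf l₀ (classSet₁₃ θ K₀ g₀) A B (badClass₁₃ θ K₀ g₀ jcut) K < 1) ∧ Summable (wInf l₀ (classSet₁₃ θ K₀ g₀) A B (badClass₁₃ θ K₀ g₀ jcut)) :=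
  exists_relWeightBound_iff_lt_one_summable (fun K t _ x _ => hA K t x) (fun K t _ x _ => hB K t x) fun K t _ => badClass₁₃_subset θ K₀ g₀ jcut K t

end Canonical

/-! ## §3  The dial: monotone at one step; `= 1` above the window given a positive run-A class total -/

section Dial

variable (hA : ∀ (K : ℕ) (t : ℝ) (x : Σ K, SiteSeqKey F (K₀ + K)), 0 ≤ A K t x) (hB : ∀ (K : ℕ) (t : ℝ) (x : Σ K, SiteSeqKey F (K₀ + K)), 0 ≤ B K t x)
include hA hB

/-- **★ A DEEPER CUT BOOKS A LARGER CANONICAL FRACTION, STEP-LOCALLY**: `jcut K ≤ jcut' K ⇒ wInf(jcut) K ≤ wInf(jcut') K`, any carriers `≥ 0`.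
[cite: Balaban1989LargeFieldII, (1.80) p.384 (bookkeeping)] -/
theorem wInf_classSet₁₃_mono_at {jcut jcut' : ℕ → ℕ} {K : ℕ} (h : jcut K ≤ jcut' K) :
    wInf l₀ (classSet₁₃ θ K₀ g₀) A B (badClass₁₃ θ K₀ g₀ jcut) K ≤ wInf l₀ (classSet₁₃ θ K₀ g₀) A B (badClass₁₃ θ K₀ g₀ jcut') K :=
  wInf_mono_of_subset_at (fun t _ x _ => hA K t x) (fun t _ x _ => hB K t x) (fun t _ => badClass₁₃_mono_at θ K₀ g₀ h t)
    (fun t _ => badClass₁₃_subset θ K₀ g₀ jcut' K t)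

/-- **★ ABOVE THE WINDOW THE CANONICAL FRACTION IS EXACTLY `1`**: `K₀ + K < jcut K` (every keyed class is bad, g2's `badClass₁₃_eq_classSet₁₃_of_overCut`) and a positive run-A class total at
one admissible source `|t₀| ≤ l₀` ⇒ `wInf K = 1`.  At a reading of record on the live line the positivity is E1 + `schemeZ_pos_datumOfRecord₁₃CoPH`.
[cite: Balaban1988Convergent, (2.18) p.257; Balaban1989LargeFieldII, (1.80) p.384; King1986, (3.10)–(3.11) p.656 (bookkeeping)] -/
theorem wInf_classSet₁₃_eq_one_of_overCut {jcut : ℕ → ℕ} {K : ℕ} (hK : K₀ + K < jcut K) {t₀ : ℝ} (ht₀ : |t₀| ≤ l₀)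
    (hpos : 0 < ∑ x ∈ classSet₁₃ θ K₀ g₀ K, A K t₀ x) :
    wInf l₀ (classSet₁₃ θ K₀ g₀) A B (badClass₁₃ θ K₀ g₀ jcut) K = 1 :=
  wInf_eq_one_of_bad_eq (fun K t _ x _ => hA K t x) (fun K t _ x _ => hB K t x) (fun K t _ => badClass₁₃_subset θ K₀ g₀ jcut K t) ht₀
    (badClass₁₃_eq_classSet₁₃_of_overCut θ K₀ g₀ jcut K t₀ hK) hpos

/-- **HENCE AN N20 WITNESS KEEPS THE CUT INSIDE THE WINDOW** whenever run A's class totals are positive at some admissible source at every step.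
[cite: Balaban1989LargeFieldII, (1.80) p.384; King1986, (3.10)–(3.11) p.656 (bookkeeping)] -/
theorem cut_le_of_relWeightBound_classSet₁₃ {jcut : ℕ → ℕ} {W : ℕ → ℝ} (hW : RelWeightBound l₀ (classSet₁₃ θ K₀ g₀) A B (badClass₁₃ θ K₀ g₀ jcut) W)
    (hpos : ∀ K, ∃ t₀ : ℝ, |t₀| ≤ l₀ ∧ 0 < ∑ x ∈ classSet₁₃ θ K₀ g₀ K, A K t₀ x) (K : ℕ) : jcut K ≤ K₀ + K := by
  by_contra hK
  obtain ⟨t₀, ht₀, hp⟩ := hpos K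
  have h1 : wInf l₀ (classSet₁₃ θ K₀ g₀) A B (badClass₁₃ θ K₀ g₀ jcut) K < 1 := (wInf_le_of_relWeightBound hW K).trans_lt (hW.lt_one K)
  rw [wInf_classSet₁₃_eq_one_of_overCut θ K₀ g₀ l₀ hA hB (lt_of_not_ge hK) ht₀ hp] at h1
  exact lt_irrefl _ h1

end Dial

/-! ## §4  The interior priced: per-birth-level fractions; print's survival shape (NE7b's body at the carriers — NAMED OPEN) -/

section Levels

variable (hA : ∀ (K : ℕ) (t : ℝ) (x : Σ K, SiteSeqKey F (K₀ + K)), 0 ≤ A K t x) (hB : ∀ (K : ℕ) (t : ℝ) (x : Σ K, SiteSeqKey F (K₀ + K)), 0 ≤ B K t x)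
  (jcut : ℕ → ℕ) [DecidableEq (Σ K, SiteSeqKey F (K₀ + K))]
include hA hB

/-- **★★ THE CANONICAL FRACTION IS AT MOST THE SUM OF THE PER-BIRTH-LEVEL FRACTIONS**, any carriers `≥ 0`: per-stratum relative bounds `a j K ≥ 0` (run A), `b j K` (run B) of the strata
«first large field exactly at level `j+1`», `j < jcut K`, `|t| ≤ l₀` ⇒ `wInf K ≤ Σ_{j<jcut K} max (a j K) (b j K)` (g3's EXACT stratification `sum_badClass₁₃_eq_sum_strata`).
[cite: Balaban1989LargeFieldII, (1.80) p.384, (1.85)–(1.89) pp.386–387; King1986, (3.10)–(3.11) p.656 (bookkeeping)] -/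
theorem wInf_classSet₁₃_le_sum_levels {a b : ℕ → ℕ → ℝ} (K : ℕ) (ha : ∀ j < jcut K, 0 ≤ a j K)
    (hAj : ∀ t : ℝ, |t| ≤ l₀ → ∀ j < jcut K,
      ∑ x ∈ badClass₁₃ θ K₀ g₀ (fun _ => j + 1) K t \ badClass₁₃ θ K₀ g₀ (fun _ => j) K t, A K t x ≤ a j K * ∑ x ∈ classSet₁₃ θ K₀ g₀ K, A K t x)
    (hBj : ∀ t : ℝ, |t| ≤ l₀ → ∀ j < jcut K,
      ∑ x ∈ badClass₁₃ θ K₀ g₀ (fun _ => j + 1) K t \ badClass₁₃ θ K₀ g₀ (fun _ => j) K t, B K t x ≤ b j K * ∑ x ∈ classSet₁₃ θ K₀ g₀ K, B K t x) :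
    wInf l₀ (classSet₁₃ θ K₀ g₀) A B (badClass₁₃ θ K₀ g₀ jcut) K ≤ ∑ j ∈ Finset.range (jcut K), max (a j K) (b j K) := by
  refine wInf_le_of_mem ⟨Finset.sum_nonneg fun j hj => (ha j (Finset.mem_range.1 hj)).trans (le_max_left _ _), fun t ht => ⟨?_, ?_⟩⟩
  · rw [sum_badClass₁₃_eq_sum_strata θ K₀ g₀ jcut K t, Finset.sum_mul]
    exact Finset.sum_le_sum fun j hj => (hAj t ht j (Finset.mem_range.1 hj)).trans
      (mul_le_mul_of_nonneg_right (le_max_left _ _) (Finset.sum_nonneg fun x _ => hA K t x))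
  · rw [sum_badClass₁₃_eq_sum_strata θ K₀ g₀ jcut K t, Finset.sum_mul]
    exact Finset.sum_le_sum fun j hj => (hBj t ht j (Finset.mem_range.1 hj)).trans
      (mul_le_mul_of_nonneg_right (le_max_right _ _) (Finset.sum_nonneg fun x _ => hB K t x))

/-- **N20 ON THE KEYED CLASS SET FROM PER-BIRTH-LEVEL BUDGETS** (level sums `< 1` at every step, summable over `K` ⇒ `RelWeightBound` at the canonical weight).  The budgets are NE7b's
body at the carriers — NAMED OPEN. [cite: Balaban1989LargeFieldII, Thm 1 + (0.1) pp.355–356, (1.80) p.384; King1986, (3.10)–(3.11) p.656 (bookkeeping)] -/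
theorem relWeightBound_wInf_classSet₁₃_of_levelFractions {a b : ℕ → ℕ → ℝ} (ha : ∀ K, ∀ j < jcut K, 0 ≤ a j K)
    (hAj : ∀ (K : ℕ) (t : ℝ), |t| ≤ l₀ → ∀ j < jcut K,
      ∑ x ∈ badClass₁₃ θ K₀ g₀ (fun _ => j + 1) K t \ badClass₁₃ θ K₀ g₀ (fun _ => j) K t, A K t x ≤ a j K * ∑ x ∈ classSet₁₃ θ K₀ g₀ K, A K t x)
    (hBj : ∀ (K : ℕ) (t : ℝ), |t| ≤ l₀ → ∀ j < jcut K,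
      ∑ x ∈ badClass₁₃ θ K₀ g₀ (fun _ => j + 1) K t \ badClass₁₃ θ K₀ g₀ (fun _ => j) K t, B K t x ≤ b j K * ∑ x ∈ classSet₁₃ θ K₀ g₀ K, B K t x)
    (hlt : ∀ K, ∑ j ∈ Finset.range (jcut K), max (a j K) (b j K) < 1) (hsum : Summable fun K => ∑ j ∈ Finset.range (jcut K), max (a j K) (b j K)) :
    RelWeightBound l₀ (classSet₁₃ θ K₀ g₀) A B (badClass₁₃ θ K₀ g₀ jcut) (wInf l₀ (classSet₁₃ θ K₀ g₀) A B (badClass₁₃ θ K₀ g₀ jcut)) := by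
  have hle : ∀ K, wInf l₀ (classSet₁₃ θ K₀ g₀) A B (badClass₁₃ θ K₀ g₀ jcut) K ≤ ∑ j ∈ Finset.range (jcut K), max (a j K) (b j K) := fun K =>
    wInf_classSet₁₃_le_sum_levels θ K₀ g₀ l₀ hA hB jcut K (ha K) (hAj K) (hBj K)
  exact (relWeightBound_wInf_classSet₁₃_iff θ K₀ g₀ l₀ hA hB jcut).2
    ⟨fun K => (hle K).trans_lt (hlt K), Summable.of_nonneg_of_le (fun K => wInf_nonneg K) hle hsum⟩

/-- **★★ THE CANONICAL FRACTION UNDER A PER-BIRTH-LEVEL SURVIVAL RATE**, any carriers `≥ 0`: cut inside the window and stratum-`j` masses `≤ V·r^{K₀+K−(j+1)} ·` (run total) in both runs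
(`0 ≤ r < 1`, `0 ≤ V`) ⇒ `wInf K ≤ V·r^{K₀+K−jcut K}∕(1−r)` — GEOMETRIC IN THE AGE FLOOR.
[cite: Balaban1989LargeFieldII, (1.80) p.384, (1.89) p.387; Balaban1989LargeFieldI, p.177 (i)–(ii); King1986, (3.10)–(3.11) p.656 (bookkeeping)] -/
theorem wInf_classSet₁₃_le_survival {r V : ℝ} (h0 : 0 ≤ r) (h1 : r < 1) (hV : 0 ≤ V) (K : ℕ) (hwin : jcut K ≤ K₀ + K)
    (hAj : ∀ t : ℝ, |t| ≤ l₀ → ∀ j < jcut K,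
      ∑ x ∈ badClass₁₃ θ K₀ g₀ (fun _ => j + 1) K t \ badClass₁₃ θ K₀ g₀ (fun _ => j) K t, A K t x ≤ V * r ^ (K₀ + K - (j + 1)) * ∑ x ∈ classSet₁₃ θ K₀ g₀ K, A K t x)
    (hBj : ∀ t : ℝ, |t| ≤ l₀ → ∀ j < jcut K,
      ∑ x ∈ badClass₁₃ θ K₀ g₀ (fun _ => j + 1) K t \ badClass₁₃ θ K₀ g₀ (fun _ => j) K t, B K t x ≤ V * r ^ (K₀ + K - (j + 1)) * ∑ x ∈ classSet₁₃ θ K₀ g₀ K, B K t x) :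
    wInf l₀ (classSet₁₃ θ K₀ g₀) A B (badClass₁₃ θ K₀ g₀ jcut) K ≤ V * r ^ (K₀ + K - jcut K) / (1 - r) := by
  have hnn : ∀ j < jcut K, 0 ≤ V * r ^ (K₀ + K - (j + 1)) := fun j _ => mul_nonneg hV (pow_nonneg h0 _)
  refine (wInf_classSet₁₃_le_sum_levels θ K₀ g₀ l₀ hA hB jcut (a := fun j K => V * r ^ (K₀ + K - (j + 1))) (b := fun j K => V * r ^ (K₀ + K - (j + 1))) K
    hnn hAj hBj).trans ?_
  simp only [max_self]
  rw [← Finset.mul_sum, mul_div_assoc]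
  exact mul_le_mul_of_nonneg_left (sum_range_pow_age_le h0 h1 hwin) hV

/-- **★★ N20 ON THE KEYED CLASS SET FROM A PER-BIRTH-LEVEL SURVIVAL RATE** (the domination at every step, `V·r^{K₀+K−jcut K}∕(1−r) < 1`, `Σ_K V·r^{K₀+K−jcut K} < ∞`).  The survival
domination is NE7b's body in the renewal currency — a HYPOTHESIS, NAMED OPEN (NOT PRINTED for `d = 4`, NOT proved).
[cite: Balaban1989LargeFieldII, Thm 1 + (0.1) pp.355–356, (1.80) p.384, (1.89) p.387; King1986, (3.10)–(3.11) p.656 (bookkeeping)] -/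
theorem relWeightBound_wInf_classSet₁₃_of_survival {r V : ℝ} (h0 : 0 ≤ r) (h1 : r < 1) (hV : 0 ≤ V) (hwin : ∀ K, jcut K ≤ K₀ + K)
    (hAj : ∀ (K : ℕ) (t : ℝ), |t| ≤ l₀ → ∀ j < jcut K,
      ∑ x ∈ badClass₁₃ θ K₀ g₀ (fun _ => j + 1) K t \ badClass₁₃ θ K₀ g₀ (fun _ => j) K t, A K t x ≤ V * r ^ (K₀ + K - (j + 1)) * ∑ x ∈ classSet₁₃ θ K₀ g₀ K, A K t x)
    (hBj : ∀ (K : ℕ) (t : ℝ), |t| ≤ l₀ → ∀ j < jcut K,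
      ∑ x ∈ badClass₁₃ θ K₀ g₀ (fun _ => j + 1) K t \ badClass₁₃ θ K₀ g₀ (fun _ => j) K t, B K t x ≤ V * r ^ (K₀ + K - (j + 1)) * ∑ x ∈ classSet₁₃ θ K₀ g₀ K, B K t x)
    (hlt : ∀ K, V * r ^ (K₀ + K - jcut K) / (1 - r) < 1) (hsum : Summable fun K => V * r ^ (K₀ + K - jcut K)) :
    RelWeightBound l₀ (classSet₁₃ θ K₀ g₀) A B (badClass₁₃ θ K₀ g₀ jcut) (wInf l₀ (classSet₁₃ θ K₀ g₀) A B (badClass₁₃ θ K₀ g₀ jcut)) := by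
  have hle : ∀ K, wInf l₀ (classSet₁₃ θ K₀ g₀) A B (badClass₁₃ θ K₀ g₀ jcut) K ≤ V * r ^ (K₀ + K - jcut K) / (1 - r) := fun K =>
    wInf_classSet₁₃_le_survival θ K₀ g₀ l₀ hA hB jcut h0 h1 hV K (hwin K) (hAj K) (hBj K)
  exact (relWeightBound_wInf_classSet₁₃_iff θ K₀ g₀ l₀ hA hB jcut).2
    ⟨fun K => (hle K).trans_lt (hlt K), Summable.of_nonneg_of_le (fun K => wInf_nonneg K) hle (hsum.div_const (1 - r))⟩

/-- **… WITH A LINEAR AGE FLOOR** `c·K ≤ K₀+K−jcut K` (`c > 0`, `0 < r`) supplying the summability (g3's `summable_ageMajorant_of_linearAge`).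
[cite: Balaban1989LargeFieldII, Thm 1 + (0.1) pp.355–356, (1.80) p.384, (1.89) p.387; King1986, (3.10)–(3.11) p.656 (bookkeeping)] -/
theorem relWeightBound_wInf_classSet₁₃_of_survival_linearAge {r V c : ℝ} (h0 : 0 < r) (h1 : r < 1) (hV : 0 ≤ V) (hc : 0 < c)
    (hwin : ∀ K, jcut K ≤ K₀ + K) (hfrac : ∀ K : ℕ, c * K ≤ ((K₀ + K - jcut K : ℕ) : ℝ))
    (hAj : ∀ (K : ℕ) (t : ℝ), |t| ≤ l₀ → ∀ j < jcut K,
      ∑ x ∈ badClass₁₃ θ K₀ g₀ (fun _ => j + 1) K t \ badClass₁₃ θ K₀ g₀ (fun _ => j) K t, A K t x ≤ V * r ^ (K₀ + K - (j + 1)) * ∑ x ∈ classSet₁₃ θ K₀ g₀ K, A K t x)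
    (hBj : ∀ (K : ℕ) (t : ℝ), |t| ≤ l₀ → ∀ j < jcut K,
      ∑ x ∈ badClass₁₃ θ K₀ g₀ (fun _ => j + 1) K t \ badClass₁₃ θ K₀ g₀ (fun _ => j) K t, B K t x ≤ V * r ^ (K₀ + K - (j + 1)) * ∑ x ∈ classSet₁₃ θ K₀ g₀ K, B K t x)
    (hlt : ∀ K, V * r ^ (K₀ + K - jcut K) / (1 - r) < 1) :
    RelWeightBound l₀ (classSet₁₃ θ K₀ g₀) A B (badClass₁₃ θ K₀ g₀ jcut) (wInf l₀ (classSet₁₃ θ K₀ g₀) A B (badClass₁₃ θ K₀ g₀ jcut)) :=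
  relWeightBound_wInf_classSet₁₃_of_survival θ K₀ g₀ l₀ hA hB jcut h0.le h1 hV hwin hAj hBj hlt (summable_ageMajorant_of_linearAge h0 h1 hV hc hfrac)

/-- **★★ THE AGE-MOMENT SOCKET (Markov in the AGE currency)**, any carriers `≥ 0`: if at step `K` (cut inside the window) the `z`-exponential AGE moment of the persistence strata —
`Σ_{j<jcut K} z^{K₀+K−(j+1)} · (stratum-j mass)` — is at most `M K ·` (run total) in both runs (`1 ≤ z`, `0 ≤ M K`, `|t| ≤ l₀`), then `wInf K ≤ M K ∕ z^{K₀+K−jcut K}`: every stratum below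
the cut is at least as old as the AGE FLOOR (truncated subtraction; no window row needed), so its mass is over-counted by `z^{age−floor} ≥ 1`.  The survival letter `V·r^{age}` of `wInf_classSet₁₃_le_survival` is the per-value form
of this letter (it gives the moment bound `M = V·Σ_j (rz)^{age_j} ≤ V∕(1−rz)` for `rz < 1`); the moment form loses no `1∕(1−r)`.
[cite: Balaban1989LargeFieldII, (1.80) p.384, (1.89) p.387; King1986, (3.10)–(3.11) p.656 (bookkeeping)] -/
theorem wInf_classSet₁₃_le_ageMoment {z : ℝ} (hz : 1 ≤ z) {M : ℕ → ℝ} (K : ℕ) (hM : 0 ≤ M K)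
    (hAm : ∀ t : ℝ, |t| ≤ l₀ →
      ∑ j ∈ Finset.range (jcut K), z ^ (K₀ + K - (j + 1)) * ∑ x ∈ badClass₁₃ θ K₀ g₀ (fun _ => j + 1) K t \ badClass₁₃ θ K₀ g₀ (fun _ => j) K t, A K t x ≤
        M K * ∑ x ∈ classSet₁₃ θ K₀ g₀ K, A K t x)
    (hBm : ∀ t : ℝ, |t| ≤ l₀ →
      ∑ j ∈ Finset.range (jcut K), z ^ (K₀ + K - (j + 1)) * ∑ x ∈ badClass₁₃ θ K₀ g₀ (fun _ => j + 1) K t \ badClass₁₃ θ K₀ g₀ (fun _ => j) K t, B K t x ≤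
        M K * ∑ x ∈ classSet₁₃ θ K₀ g₀ K, B K t x) :
    wInf l₀ (classSet₁₃ θ K₀ g₀) A B (badClass₁₃ θ K₀ g₀ jcut) K ≤ M K / z ^ (K₀ + K - jcut K) := by
  have hz0 : 0 < z := zero_lt_one.trans_le hz
  have hfl : 0 < z ^ (K₀ + K - jcut K) := pow_pos hz0 _
  -- every stratum below the cut is at least as old as the age floor
  have hage : ∀ j ∈ Finset.range (jcut K), (1 : ℝ) ≤ z ^ (K₀ + K - (j + 1)) / z ^ (K₀ + K - jcut K) := fun j hj =>
    (one_le_div hfl).2 (pow_le_pow_right₀ hz (Nat.sub_le_sub_left (Finset.mem_range.1 hj) _))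
  have key : ∀ (C : ℕ → ℝ → (Σ K, SiteSeqKey F (K₀ + K)) → ℝ), (∀ (K : ℕ) (t : ℝ) x, 0 ≤ C K t x) → ∀ t : ℝ,
      (∑ j ∈ Finset.range (jcut K), z ^ (K₀ + K - (j + 1)) * ∑ x ∈ badClass₁₃ θ K₀ g₀ (fun _ => j + 1) K t \ badClass₁₃ θ K₀ g₀ (fun _ => j) K t, C K t x ≤
        M K * ∑ x ∈ classSet₁₃ θ K₀ g₀ K, C K t x) →
      ∑ x ∈ badClass₁₃ θ K₀ g₀ jcut K t, C K t x ≤ M K / z ^ (K₀ + K - jcut K) * ∑ x ∈ classSet₁₃ θ K₀ g₀ K, C K t x := by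
    intro C hC t hm
    rw [sum_badClass₁₃_eq_sum_strata θ K₀ g₀ jcut K t]
    calc ∑ j ∈ Finset.range (jcut K), ∑ x ∈ badClass₁₃ θ K₀ g₀ (fun _ => j + 1) K t \ badClass₁₃ θ K₀ g₀ (fun _ => j) K t, C K t x
        ≤ ∑ j ∈ Finset.range (jcut K), z ^ (K₀ + K - (j + 1)) / z ^ (K₀ + K - jcut K) *
            ∑ x ∈ badClass₁₃ θ K₀ g₀ (fun _ => j + 1) K t \ badClass₁₃ θ K₀ g₀ (fun _ => j) K t, C K t x :=
          Finset.sum_le_sum fun j hj => le_mul_of_one_le_left (Finset.sum_nonneg fun x _ => hC K t x) (hage j hj)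
      _ = (∑ j ∈ Finset.range (jcut K), z ^ (K₀ + K - (j + 1)) * ∑ x ∈ badClass₁₃ θ K₀ g₀ (fun _ => j + 1) K t \ badClass₁₃ θ K₀ g₀ (fun _ => j) K t, C K t x) /
            z ^ (K₀ + K - jcut K) := by
          rw [Finset.sum_div]
          exact Finset.sum_congr rfl fun j _ => by rw [div_mul_eq_mul_div]
      _ ≤ (M K * ∑ x ∈ classSet₁₃ θ K₀ g₀ K, C K t x) / z ^ (K₀ + K - jcut K) := div_le_div_of_nonneg_right hm hfl.le
      _ = M K / z ^ (K₀ + K - jcut K) * ∑ x ∈ classSet₁₃ θ K₀ g₀ K, C K t x := by ring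
  exact wInf_le_of_mem ⟨div_nonneg hM hfl.le, fun t ht => ⟨key A hA t (hAm t ht), key B hB t (hBm t ht)⟩⟩

/-- **N20 ON THE KEYED CLASS SET FROM ONE AGE MOMENT PER RUN AND STEP** (`M K ∕ z^{K₀+K−jcut K} < 1` at every step and summable; no window row): the generating-function form of
the survival design rule.  The moment letter is NE7b's body — NAMED OPEN. [cite: Balaban1989LargeFieldII, Thm 1 + (0.1) pp.355–356, (1.80) p.384, (1.89) p.387; King1986, (3.10)–(3.11) p.656 (bookkeeping)] -/
theorem relWeightBound_wInf_classSet₁₃_of_ageMoment {z : ℝ} (hz : 1 ≤ z) {M : ℕ → ℝ} (hM : ∀ K, 0 ≤ M K)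
    (hAm : ∀ (K : ℕ) (t : ℝ), |t| ≤ l₀ →
      ∑ j ∈ Finset.range (jcut K), z ^ (K₀ + K - (j + 1)) * ∑ x ∈ badClass₁₃ θ K₀ g₀ (fun _ => j + 1) K t \ badClass₁₃ θ K₀ g₀ (fun _ => j) K t, A K t x ≤
        M K * ∑ x ∈ classSet₁₃ θ K₀ g₀ K, A K t x)
    (hBm : ∀ (K : ℕ) (t : ℝ), |t| ≤ l₀ →
      ∑ j ∈ Finset.range (jcut K), z ^ (K₀ + K - (j + 1)) * ∑ x ∈ badClass₁₃ θ K₀ g₀ (fun _ => j + 1) K t \ badClass₁₃ θ K₀ g₀ (fun _ => j) K t, B K t x ≤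
        M K * ∑ x ∈ classSet₁₃ θ K₀ g₀ K, B K t x)
    (hlt : ∀ K, M K / z ^ (K₀ + K - jcut K) < 1) (hsum : Summable fun K => M K / z ^ (K₀ + K - jcut K)) :
    RelWeightBound l₀ (classSet₁₃ θ K₀ g₀) A B (badClass₁₃ θ K₀ g₀ jcut) (wInf l₀ (classSet₁₃ θ K₀ g₀) A B (badClass₁₃ θ K₀ g₀ jcut)) := by
  have hle : ∀ K, wInf l₀ (classSet₁₃ θ K₀ g₀) A B (badClass₁₃ θ K₀ g₀ jcut) K ≤ M K / z ^ (K₀ + K - jcut K) := fun K =>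
    wInf_classSet₁₃_le_ageMoment θ K₀ g₀ l₀ hA hB jcut hz K (hM K) (hAm K) (hBm K)
  exact (relWeightBound_wInf_classSet₁₃_iff θ K₀ g₀ l₀ hA hB jcut).2
    ⟨fun K => (hle K).trans_lt (hlt K), Summable.of_nonneg_of_le (fun K => wInf_nonneg K) hle hsum⟩

end Levels

/-! ## §5  The wall and the honesty: first-level saturation of run A's carriers (DISPLAYED) -/

section Wall

variable (hA : ∀ (K : ℕ) (t : ℝ) (x : Σ K, SiteSeqKey F (K₀ + K)), 0 ≤ A K t x)
include hA

/-- **FRACTION EXTRACTION AT A CUTTING STEP, run A, any carriers `≥ 0`**: a `RelWeightBound` at the policy-`jcut` class, `1 ≤ jcut K`, a source `|t| ≤ l₀` with positive run-A mass of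
which the FIRST-LEVEL class holds the fraction `c` ⇒ `c ≤ W K`. [cite: Balaban1989LargeFieldII, (1.80) p.384; King1986, (3.10)–(3.11) p.656 (bookkeeping)] -/
theorem le_weight_of_levelOne_fraction_classSet₁₃ {jcut : ℕ → ℕ} {W : ℕ → ℝ} (hW : RelWeightBound l₀ (classSet₁₃ θ K₀ g₀) A B (badClass₁₃ θ K₀ g₀ jcut) W)
    {K : ℕ} (hK : 1 ≤ jcut K) {t c : ℝ} (ht : |t| ≤ l₀) (hpos : 0 < ∑ x ∈ classSet₁₃ θ K₀ g₀ K, A K t x)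
    (hc : c * ∑ x ∈ classSet₁₃ θ K₀ g₀ K, A K t x ≤ ∑ x ∈ badClass₁₃ θ K₀ g₀ (fun _ => 1) K t, A K t x) : c ≤ W K :=
  le_weight_of_fraction_le hW ht hpos
    (hc.trans (Finset.sum_le_sum_of_subset_of_nonneg (badClass₁₃_levelOne_subset_of_one_le θ K₀ g₀ hK t) fun x _ _ => hA K t x))

/-- **★ THE WALL, ANY CARRIERS: UNDER EVENTUAL FIRST-LEVEL SATURATION OF RUN A EVERY N20-ADMISSIBLE POLICY IS EVENTUALLY THE ZERO CUT** (a fraction `c > 0` from some cutoff on, DISPLAYED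
— dag-n20-w3's count; `c ≤ W K` infinitely often contradicts `Summable W`). [cite: Balaban1989LargeFieldII, (1.80) p.384; King1986, (3.10)–(3.11) p.656 (bookkeeping)] -/
theorem eventually_cut_eq_zero_of_relWeightBound_classSet₁₃ {c : ℝ} (hc : 0 < c)
    (hsat : ∀ᶠ K in atTop, ∃ t : ℝ, |t| ≤ l₀ ∧ 0 < ∑ x ∈ classSet₁₃ θ K₀ g₀ K, A K t x ∧
      c * ∑ x ∈ classSet₁₃ θ K₀ g₀ K, A K t x ≤ ∑ x ∈ badClass₁₃ θ K₀ g₀ (fun _ => 1) K t, A K t x)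
    {jcut : ℕ → ℕ} {W : ℕ → ℝ} (hW : RelWeightBound l₀ (classSet₁₃ θ K₀ g₀) A B (badClass₁₃ θ K₀ g₀ jcut) W) :
    ∀ᶠ K in atTop, jcut K = 0 := by
  by_contra h
  have hfr : ∃ᶠ K in atTop, jcut K ≠ 0 := Filter.not_eventually.1 h
  refine not_summable_of_frequently_le hc ((hsat.and_frequently hfr).mono fun K hK => ?_) hW.summable
  obtain ⟨⟨t, ht, hpos, hle⟩, hK⟩ := hK
  exact le_weight_of_levelOne_fraction_classSet₁₃ θ K₀ g₀ l₀ hA hW (Nat.one_le_iff_ne_zero.2 hK) ht hpos hle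

variable [DecidableEq (Σ K, SiteSeqKey F (K₀ + K))]

omit hA in
/-- **HONESTY, ANY CARRIERS: THE RUN-A SURVIVAL LETTER AND EVENTUAL FIRST-LEVEL SATURATION MEET ONLY ALONG EVENTUALLY-ZERO CUTS** (the stratum-`0` factor `V·r^{K₀+K−1} → 0` falls below
the saturation fraction `κ > 0`; g3 p613049's located fact at the cumulative key, for any carriers). [cite: Balaban1989LargeFieldII, (1.80) p.384, (1.89) p.387; King1986, (3.10)–(3.11) p.656 (bookkeeping)] -/
theorem eventually_cut_eq_zero_of_survival_of_saturated_classSet₁₃ {r V κ : ℝ} (h0 : 0 ≤ r) (h1 : r < 1) (hκ0 : 0 < κ) (jcut : ℕ → ℕ)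
    (hAj : ∀ (K : ℕ) (t : ℝ), |t| ≤ l₀ → ∀ j < jcut K,
      ∑ x ∈ badClass₁₃ θ K₀ g₀ (fun _ => j + 1) K t \ badClass₁₃ θ K₀ g₀ (fun _ => j) K t, A K t x ≤ V * r ^ (K₀ + K - (j + 1)) * ∑ x ∈ classSet₁₃ θ K₀ g₀ K, A K t x)
    (hsat : ∀ᶠ K in atTop, ∃ t : ℝ, |t| ≤ l₀ ∧ 0 < ∑ x ∈ classSet₁₃ θ K₀ g₀ K, A K t x ∧
      κ * ∑ x ∈ classSet₁₃ θ K₀ g₀ K, A K t x ≤ ∑ x ∈ badClass₁₃ θ K₀ g₀ (fun _ => 1) K t, A K t x) :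
    ∀ᶠ K in atTop, jcut K = 0 := by
  have hage : Tendsto (fun K : ℕ => K₀ + K - 1) atTop atTop := tendsto_atTop_atTop.2 fun b => ⟨b + 1, fun K hK => by omega⟩
  have hlim : Tendsto (fun K : ℕ => V * r ^ (K₀ + K - 1)) atTop (𝓝 0) := by
    simpa using ((tendsto_pow_atTop_nhds_zero_of_lt_one h0 h1).comp hage).const_mul V
  filter_upwards [hsat, hlim.eventually (gt_mem_nhds hκ0)] with K hK hlt
  obtain ⟨t, ht, hpos, hle⟩ := hK
  by_contra hne
  have hcut : 0 < jcut K := Nat.pos_of_ne_zero hne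
  have hA0 := hAj K t ht 0 hcut
  rw [badClass₁₃_level_zero θ K₀ g₀ K t, Finset.sdiff_empty] at hA0
  exact (lt_irrefl κ) ((le_of_mul_le_mul_right (hle.trans hA0) hpos).trans_lt hlt)

end Wall

/-! ## §6  Dictionary: the readings of record ARE instances (`rfl`) -/

section Dictionary

variable (hP : θ.Provisos₁₃CoPH F N) (os : List (ULoop F)) (jcut : ℕ → ℕ) (sh : ShellSplit₁₃CoPH N K₀)

/-- The V reading's weight field IS the canonical weight on the keyed class set at the carriers of record (`rfl`). [cite: Balaban1989LargeFieldII, (1.80) p.384 (bookkeeping)] -/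
theorem W_crOfRecord₁₃VAt_eq_wInf :
    (crOfRecord₁₃VAt K₀ jcut sh F θ hP g₀ os).W = wInf 1 (classSet₁₃ θ K₀ g₀) (weightA₁₃ θ hP K₀ g₀ os) (weightB₁₃ θ hP K₀ g₀ os) (badClass₁₃ θ K₀ g₀ jcut) := rfl

/-- The v1.0 reading's weight field, likewise (`rfl`). [cite: Balaban1989LargeFieldII, (1.80) p.384 (bookkeeping)] -/
theorem W_crOfRecord₁₃At_eq_wInf :
    (crOfRecord₁₃At K₀ jcut sh F θ hP g₀ os).W = wInf 1 (classSet₁₃ θ K₀ g₀) (weightA₁₃ θ hP K₀ g₀ os) (weightB₁₃ θ hP K₀ g₀ os) (badClass₁₃ θ K₀ g₀ jcut) := rfl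

end Dictionary

end Summit.QuantumFields.YangMills.BalabanUVNodes.N20KeyedRelWeightAnyCarriers

end
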